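import Summits.ABC.StewartYu.ArchG3Schedule
import Summits.ABC.StewartYu.PadicG3StartR
import Summits.ABC.StewartYu.SiegelOnFinset
import Literature.NumberTheory.DiophantineGeometry.SaturatedBoxCount
import HarnessLib

/-!
# Cell abc-stewartyu, rung A1.L (crux r2 `ArchCoreRat`), WP-L.A: the START of the archimedean frame in Δ-form — slab pigeonhole, re-basing
# to a member of the class, Siegel's lemma on the Δ-equations, and the level-`0` invariant / state

`Summits/ABC/StewartYu/ArchG3Start.lean` — cell `abc-stewartyu` (HOME `run/shared/lean/pub/abc-stewartyu/`; TRANCHE PLAN v1.2 §4′ P-A2 structural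
half, design memo HOME/p1/memo/ArchG3-START-design-g9.md §3 «design B»; seat lp-1 g8, announced STATUS 2026-08-27 «MINE ArchG3Start»).
Definitions (`boxA`, `unkA` — the box of exponents and the unknown set) and theorems on `ArchG3Setup`; no named fact, no numerics (the record
supplies the COUNT `hcount` and the coefficient size `Amax`).  Archimedean twin of `PadicG3StartR.start_restricted` / `PadicG3SatStart.start_sat`
(seat p2), generic in the candidate exponent set `𝔅 ⊆ boxA s` (the full box for the Kummer-conditional frame over `ℤⁿ`; an `𝔑`-box for a
threaded frame):

1. SLAB PIGEONHOLE (design B, replacing Matveev's thin slab / Brunn–Minkowski): the functional `λ ↦ Lsum λ = Σ λⱼ log αⱼ` has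
   `|Lsum λ| ≤ Θ := Σ sⱼ Aⱼ` on the box, so some class `𝔏 = {λ ∈ 𝔅 : c₀ ≤ Lsum λ < c₀ + w}` has `#𝔅 ≤ (2⌈Θ/w⌉₊ + 1)·#𝔏`
   (`Dioph.exists_slab_class`) — `exists_slab_subfamily`;
2. RE-BASING to a member `λ♭ ∈ 𝔏`: the relative exponents `vᵢ = λ − λ♭` lie in the interval box `[−s − λ♭, −s − λ♭ + 2s] ∋ 0` and satisfy
   `|Lsum vᵢ − 0| ≤ w` (slab centre `γ₀ = 0`, radius `w` — the `wl 0`, `γb 0 = 0` of `ArchG3Schedule`);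
3. SIEGEL (`SiegelFinset.exists_int_vec_of_finset`, exponent `1`, `2·#E ≤ #U`) on the Δ-EQUATIONS at the nodes `|x| ≤ X₀` and multi-indices
   `(a, μ)` with `a + |μ| < T₀`, `μ_{j₀} = 0` (`tauSetR`; the equations with `μ_{j₀} > 0` hold identically since `yΔ_{j₀} = c·(𝔛_{j₀} − e_{j₀}) = 0`
   for `e_{j₀} = 0` and `multichoose 0 (k+1) = 0`): coefficients `qTermΔ` (`archφ_pvΔ_zero_eq_sum`), cleared by `den₀ e · monDen(α, 2s|x|)`
   (`exists_int_clear_mul_qTermΔ`), size `≤ Amax`;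
4. the LEVEL-`0` INVARIANT `ArchLvInv (R₀ i.1) (unkA L₀ 𝔏) (i.2 − λ♭) pv (−s − λ♭) (2s) ⌈#U·Amax⌉ w 0 c e {|x| ≤ X₀} T₀` (`start_delta`) and the
   STATE `ArchLevelState … 0 X₀ T₀` for the level weights `R₀ ℓ₀ = Δ(2^{Ŝ}Y₀; ℓ₀, H)` (`archLevelState_zero`).

WHAT THIS IS NOT: the count `2·#E·K ≤ (L₀+1)·#𝔅` and the size `Amax` (record, `ArchG3Par`, seat p1); no crux moves.

## References
* Yu. V. Nesterenko, LNM 1819 (2003) — §3.3 (3.12)–(3.13), Prop. 3.4 (the slab), §3.5 (3.22)–(3.30), Prop. 3.9 (the linear system and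
  Siegel's lemma), §4 (4.6) (the level-`0` identities), p. 66–81. [Nesterenko2003]
* E. M. Matveev, Izv. Math. 64 (2000) — §3 (the slab). [Matveev2000]
-/

noncomputable section

open Finset Polynomial
open Literature.NumberTheory.Transcendental
open Literature.NumberTheory.Transcendental.CW77.Setup (Tau tauNorm tauSet)
open Literature.NumberTheory.DiophantineGeometry.Dioph (exists_slab_class)
open Summit.ABC.StewartYu.ArchSupply (scaledFeldR)
open scoped Nat

namespace Summit.ABC.StewartYu

namespace ArchG3Setup

variable (S : ArchG3Setup)

/-! ### The box, the unknown set -/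

/-- The integer box `{λ : |λⱼ| ≤ sⱼ}`. [cite: Nesterenko2003, §3.5 (3.22); shape only] -/
def boxA (s : Fin S.n → ℕ) : Finset (Fin S.n → ℤ) := Fintype.piFinset fun j => Icc (-(s j : ℤ)) (s j)

/-- Membership in the box. [folklore] -/
theorem mem_boxA {s : Fin S.n → ℕ} {lam : Fin S.n → ℤ} : lam ∈ S.boxA s ↔ ∀ j, |lam j| ≤ (s j : ℤ) := by
  unfold boxA
  rw [Fintype.mem_piFinset]
  refine forall_congr' fun j => ?_
  rw [mem_Icc, abs_le]

/-- The unknown set `(ℓ₀, λ) ∈ [0, L₀] × 𝔏`. [cite: Nesterenko2003, §3.5 (the coefficients p(ℓ₀, λ)); shape only] -/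
def unkA (L₀ : ℕ) (𝔏 : Finset (Fin S.n → ℤ)) : Finset (ℕ × (Fin S.n → ℤ)) := (range (L₀ + 1)) ×ˢ 𝔏

/-- `#unkA = (L₀+1)·#𝔏`. [folklore] -/
theorem card_unkA (L₀ : ℕ) (𝔏 : Finset (Fin S.n → ℤ)) : (S.unkA L₀ 𝔏).card = (L₀ + 1) * 𝔏.card := by
  unfold unkA; rw [card_product, card_range]

/-- Membership in the unknown set. [folklore] -/
theorem mem_unkA {L₀ : ℕ} {𝔏 : Finset (Fin S.n → ℤ)} {i : ℕ × (Fin S.n → ℤ)} : i ∈ S.unkA L₀ 𝔏 ↔ i.1 ≤ L₀ ∧ i.2 ∈ 𝔏 := by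
  unfold unkA
  rw [mem_product, mem_range]
  constructor
  · rintro ⟨h1, h2⟩; exact ⟨by omega, h2⟩
  · rintro ⟨h1, h2⟩; exact ⟨by omega, h2⟩

/-! ### Step 1: the slab pigeonhole -/

/-- **A slab sub-family**: for `𝔅 ⊆ boxA s`, `|log αⱼ| ≤ Aⱼ` and `w > 0` there is `𝔏 ⊆ 𝔅` with all `Lsum λ`, `λ ∈ 𝔏`, in one half-open
interval of length `w` and `#𝔅 ≤ (2⌈(Σ sⱼAⱼ)/w⌉₊ + 1)·#𝔏`. [cite: Nesterenko2003, §3.3 (3.12), Prop. 3.4, p. 66] [cite: Matveev2000, §3] -/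
theorem exists_slab_subfamily {A : Fin S.n → ℝ} (hA : ∀ j, |S.lg j| ≤ A j) (s : Fin S.n → ℕ) {𝔅 : Finset (Fin S.n → ℤ)}
    (h𝔅 : 𝔅 ⊆ S.boxA s) {w : ℝ} (hw : 0 < w) :
    ∃ 𝔏 : Finset (Fin S.n → ℤ), 𝔏 ⊆ 𝔅 ∧ (∃ c₀ : ℝ, ∀ lam ∈ 𝔏, c₀ ≤ S.Lsum lam ∧ S.Lsum lam < c₀ + w) ∧
      𝔅.card ≤ (2 * ⌈(∑ j, (s j : ℝ) * A j) / w⌉₊ + 1) * 𝔏.card := by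
  classical
  have hΘ : ∀ lam ∈ 𝔅, |S.Lsum lam| ≤ ∑ j, (s j : ℝ) * A j :=
    fun lam hl => S.abs_Lsum_le_of_box hA (S.mem_boxA.mp (h𝔅 hl))
  obtain ⟨c₀, hc₀⟩ := exists_slab_class 𝔅 S.Lsum hw hΘ
  exact ⟨𝔅.filter fun lam => c₀ ≤ S.Lsum lam ∧ S.Lsum lam < c₀ + w, filter_subset _ _,
    ⟨c₀, fun lam hl => (mem_filter.mp hl).2⟩, hc₀⟩

/-! ### Step 3: the Δ-equations with `μ_{j₀} > 0` hold identically -/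

/-- With `e j₀ = 0` the Δ-weight in the pivot direction vanishes for `μ_{j₀} > 0`: `pvΔ pv c e μ = 0`. [folklore] -/
theorem pvΔ_eq_zero_of_pivot_pos {ι : Type*} (v : ι → Fin S.n → ℤ) (pv : ι → ℤ) (c : ℤ) {e : Fin S.n → ℤ} (he : e S.j₀ = 0)
    {μ : Fin S.n → ℕ} (hμ : 0 < μ S.j₀) (i : ι) : S.pvΔ v pv c e μ i = 0 := by
  unfold pvΔ
  have h0 : Ring.multichoose (S.yΔ c e (v i) S.j₀) (μ S.j₀) = 0 := by
    have hy : S.yΔ c e (v i) S.j₀ = 0 := by unfold yΔ; rw [S.𝔛_pivot, he]; ring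
    obtain ⟨k, hk⟩ : ∃ k, μ S.j₀ = k + 1 := ⟨μ S.j₀ - 1, by omega⟩
    rw [hy, hk, Ring.multichoose_zero_succ]
  rw [prod_eq_zero (mem_univ S.j₀) h0, mul_zero]

/-- Hence `archφ R v B (pvΔ pv c e μ) τ x = 0` for `μ_{j₀} > 0` (`e j₀ = 0`). [folklore] -/
theorem archφ_pvΔ_eq_zero_of_pivot_pos {ι : Type*} (R : ι → ℚ[X]) (v : ι → Fin S.n → ℤ) (B : Finset ι) (pv : ι → ℤ) (c : ℤ)
    {e : Fin S.n → ℤ} (he : e S.j₀ = 0) {μ : Fin S.n → ℕ} (hμ : 0 < μ S.j₀) (τ : Tau S.n) (x : ℤ) :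
    S.archφ R v B (S.pvΔ v pv c e μ) τ x = 0 := by
  unfold archφ
  refine sum_eq_zero fun i _ => ?_
  rw [S.pvΔ_eq_zero_of_pivot_pos v pv c he hμ i]
  simp

/-! ### Steps 2–4: re-basing, Siegel, the level-`0` invariant -/

/-- **THE START in Δ-form.**  Data: box sides `s`, a candidate exponent set `𝔅 ⊆ boxA s`, `Y₀`-degree `L₀`, nodes `|x| ≤ X₀`, order `T₀ ≥ 1`,
`Y₀`-weights `R₀ ℓ₀`, slab width `w > 0`, Δ-basis `(c ≠ 0, e)` with `e j₀ = 0`.  Record hypotheses: the COUNT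
`2·#E·(2⌈Θ/w⌉₊+1) ≤ (L₀+1)·#𝔅` for the equation set `E = [−X₀, X₀] × tauSetR n j₀ T₀`, `Θ = Σ sⱼAⱼ`; integrality `den₀ e·(Hasse_a R₀ ℓ₀)(x) ∈ ℤ`
with size `≤ M₀ e`; the Δ-weight size `|∏ₖ multichoose(yΔ c e w′ k, μₖ)| ≤ DΔ` on the doubled box for `(a, μ) ∈ tauSetR`; and
`DΔ·M₀ e·monDen(α, 2s|x|)² ≤ Amax`, `Amax ≥ 1`.  Conclusion: a slab class `𝔏 ⊆ 𝔅`, a member `λ♭ ∈ 𝔏` and integer coefficients `pv` with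
`ArchLvInv (R₀ i.1) (unkA L₀ 𝔏) (i.2 − λ♭) pv (−s − λ♭) (2s) ⌈#unkA·Amax⌉ w 0 c e {|x| ≤ X₀} T₀`.
[cite: Nesterenko2003, §3.5 (3.22)–(3.30), Prop. 3.9, §4 (4.6), p. 71–81] -/
theorem start_delta {A : Fin S.n → ℝ} (hA : ∀ j, |S.lg j| ≤ A j) (s : Fin S.n → ℕ) {𝔅 : Finset (Fin S.n → ℤ)} (h𝔅 : 𝔅 ⊆ S.boxA s)
    (L₀ X₀ T₀ : ℕ) (hT₀ : 1 ≤ T₀) (R₀ : ℕ → ℚ[X]) {w : ℝ} (hw : 0 < w) {c : ℤ} (hc : c ≠ 0) {e : Fin S.n → ℤ} (he : e S.j₀ = 0)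
    (E : Finset (ℤ × Tau S.n)) (hEdef : E = Icc (-(X₀ : ℤ)) X₀ ×ˢ tauSetR S.n S.j₀ T₀)
    (hcount : 2 * E.card * (2 * ⌈(∑ j, (s j : ℝ) * A j) / w⌉₊ + 1) ≤ (L₀ + 1) * 𝔅.card)
    (den₀ : ℤ × Tau S.n → ℕ) (hden₀ : ∀ q ∈ E, 1 ≤ den₀ q) (M₀ : ℤ × Tau S.n → ℤ)
    (hR : ∀ q ∈ E, ∀ ℓ₀ ≤ L₀, ∃ z₀ : ℤ, (den₀ q : ℚ) * (hasseDeriv q.2.1 (R₀ ℓ₀)).eval (q.1 : ℚ) = z₀ ∧ |z₀| ≤ M₀ q)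
    {DΔ : ℝ} (hDΔ : ∀ w' : Fin S.n → ℤ, (∀ j, |w' j| ≤ ((2 * s j : ℕ) : ℤ)) → ∀ q ∈ E,
      |((∏ k, Ring.multichoose (S.yΔ c e w' k) (q.2.2 k) : ℤ) : ℝ)| ≤ DΔ)
    {Amax : ℝ} (hAmax : 1 ≤ Amax)
    (hAm : ∀ q ∈ E, DΔ * (M₀ q : ℝ) * ((MonomialDen.monDen S.α (fun j => 2 * s j * q.1.natAbs) : ℝ)) ^ 2 ≤ Amax) :
    ∃ (𝔏 : Finset (Fin S.n → ℤ)) (lamb : Fin S.n → ℤ) (pv : ℕ × (Fin S.n → ℤ) → ℤ),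
      𝔏 ⊆ 𝔅 ∧ lamb ∈ 𝔏 ∧
      S.ArchLvInv (fun i => R₀ i.1) (S.unkA L₀ 𝔏) (fun i => i.2 - lamb) pv (fun j => -(s j : ℤ) - lamb j) (fun j => 2 * s j)
        ⌈((S.unkA L₀ 𝔏).card : ℝ) * Amax⌉ w 0 c e {x : ℤ | |x| ≤ (X₀ : ℤ)} T₀ := by
  classical
  -- Step 1: the slab class
  obtain ⟨𝔏, h𝔏𝔅, ⟨c₀, hc₀⟩, hcard𝔏⟩ := S.exists_slab_subfamily hA s h𝔅 hw
  set K : ℕ := 2 * ⌈(∑ j, (s j : ℝ) * A j) / w⌉₊ + 1 with hK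
  have hK0 : 0 < K := by omega
  have hE : E.Nonempty := by
    refine ⟨((0 : ℤ), ((0 : ℕ), fun _ => (0 : ℕ))), ?_⟩
    rw [hEdef, mem_product, mem_Icc, mem_tauSetR]
    refine ⟨⟨by omega, by omega⟩, ?_, rfl⟩
    unfold tauNorm; simp; omega
  have h𝔏ne : 𝔏.Nonempty := by
    rw [← Finset.card_pos]
    by_contra h0
    push Not at h0
    have : 𝔏.card = 0 := by omega
    rw [this, mul_zero] at hcard𝔏
    have hEpos : 0 < E.card := Finset.card_pos.mpr hE
    have h1 : 2 * E.card * K ≤ (L₀ + 1) * 0 := hcount.trans (Nat.mul_le_mul_left _ hcard𝔏)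
    have : 0 < 2 * E.card * K := by positivity
    omega
  obtain ⟨lamb, hlamb⟩ := h𝔏ne
  -- Step 2: re-basing
  set U := S.unkA L₀ 𝔏 with hU
  set v : ℕ × (Fin S.n → ℤ) → Fin S.n → ℤ := fun i => i.2 - lamb with hv
  have hbox𝔏 : ∀ lam ∈ 𝔏, ∀ j, |lam j| ≤ (s j : ℤ) := fun lam hl => S.mem_boxA.mp (h𝔅 (h𝔏𝔅 hl))
  have hvbox : ∀ i ∈ U, ∀ j, |v i j| ≤ ((2 * s j : ℕ) : ℤ) := by
    intro i hi j
    have h1 := hbox𝔏 i.2 (S.mem_unkA.mp hi).2 j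
    have h2 := hbox𝔏 lamb hlamb j
    simp only [hv, Pi.sub_apply]
    rw [abs_le] at h1 h2 ⊢
    push_cast
    constructor <;> omega
  -- the count
  have hcardU : 2 * E.card ≤ U.card := by
    rw [hU, S.card_unkA]
    have h1 : 2 * E.card * K ≤ ((L₀ + 1) * 𝔏.card) * K := by
      calc 2 * E.card * K ≤ (L₀ + 1) * 𝔅.card := hcount
        _ ≤ (L₀ + 1) * (K * 𝔏.card) := Nat.mul_le_mul_left _ hcard𝔏
        _ = ((L₀ + 1) * 𝔏.card) * K := by ring
    exact Nat.le_of_mul_le_mul_right h1 hK0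
  -- Step 3: Siegel on the Δ-equations (coefficients `qTermΔ`, denominators `den₀ · monDen`)
  set R : ℕ × (Fin S.n → ℤ) → ℚ[X] := fun i => R₀ i.1 with hRdef
  set Dq : ℤ × Tau S.n → ℕ := fun q => den₀ q * MonomialDen.monDen S.α (fun j => 2 * s j * q.1.natAbs) with hDq
  have hDq0 : ∀ q ∈ E, 0 < Dq q := fun q hq =>
    Nat.mul_pos (hden₀ q hq) (MonomialDen.one_le_monDen S.α S.α_ne _)
  have hint : ∀ q ∈ E, ∀ u ∈ U, ∃ z : ℤ, (Dq q : ℚ) * S.qTermΔ R v c e q.2.2 q.2.1 q.1 u = z := by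
    intro q hq u hu
    obtain ⟨z₀, hz₀, _⟩ := hR q hq u.1 (S.mem_unkA.mp hu).1
    obtain ⟨z, hz, _⟩ := S.exists_int_clear_mul_qTermΔ R v c e q.2.2 q.2.1 q.1 u (hvbox u hu) hz₀
    exact ⟨z, hz⟩
  have hAbd : ∀ q ∈ E, ∀ u ∈ U, |((Dq q : ℚ) * S.qTermΔ R v c e q.2.2 q.2.1 q.1 u : ℚ)| ≤ (Amax : ℝ) := by
    intro q hq u hu
    obtain ⟨z₀, hz₀, hz₀le⟩ := hR q hq u.1 (S.mem_unkA.mp hu).1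
    obtain ⟨z, hz, hzle⟩ := S.exists_int_clear_mul_qTermΔ R v c e q.2.2 q.2.1 q.1 u (hvbox u hu) hz₀
    -- the integer bound, cast to ℝ (push_cast normal form)
    have h1 : |(z : ℝ)| ≤ |∏ k, ((Ring.multichoose (S.yΔ c e (v u) k) (q.2.2 k) : ℤ) : ℝ)| * |(z₀ : ℝ)| *
        ((MonomialDen.monDen S.α (fun j => 2 * s j * q.1.natAbs) : ℝ)) ^ 2 := by
      have := (Int.cast_le (R := ℝ)).mpr hzle
      push_cast at this
      exact this
    have h3 : |∏ k, ((Ring.multichoose (S.yΔ c e (v u) k) (q.2.2 k) : ℤ) : ℝ)| ≤ DΔ := by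
      have := hDΔ (v u) (hvbox u hu) q hq
      push_cast at this
      exact this
    have h2 : |(z₀ : ℝ)| ≤ M₀ q := by
      have := (Int.cast_le (R := ℝ)).mpr hz₀le
      push_cast at this
      exact this
    have hDΔ0 : 0 ≤ DΔ := (abs_nonneg _).trans h3
    have hzR : |(z : ℝ)| ≤ DΔ * (M₀ q : ℝ) * ((MonomialDen.monDen S.α (fun j => 2 * s j * q.1.natAbs) : ℝ)) ^ 2 :=
      h1.trans (mul_le_mul_of_nonneg_right (mul_le_mul h3 h2 (abs_nonneg _) hDΔ0) (by positivity))
    have hcast : (((Dq q : ℚ) * S.qTermΔ R v c e q.2.2 q.2.1 q.1 u : ℚ)) = (z : ℚ) := hz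
    rw [hcast]
    push_cast
    exact hzR.trans (hAm q hq)
  obtain ⟨pv, hsupp, hne, hbd, hsol⟩ := SiegelFinset.exists_int_vec_of_finset U E hE hcardU
    (fun q u => S.qTermΔ R v c e q.2.2 q.2.1 q.1 u) Dq hDq0 hint hAmax hAbd
  -- Step 4: the level-0 invariant
  have hnz : ∃ i ∈ U, pv i ≠ 0 := by
    obtain ⟨u, hu⟩ := hne
    exact ⟨u, hsupp u hu, hu⟩
  have hlo : ∀ j, (fun j => -(s j : ℤ) - lamb j) j ≤ 0 ∧ 0 ≤ (fun j => -(s j : ℤ) - lamb j) j + ((2 * s j : ℕ) : ℤ) := by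
    intro j
    have h2 := hbox𝔏 lamb hlamb j
    rw [abs_le] at h2
    push_cast
    constructor <;> omega
  have hboxv : ∀ i ∈ U, ∀ j, (fun j => -(s j : ℤ) - lamb j) j ≤ v i j ∧ v i j ≤ (fun j => -(s j : ℤ) - lamb j) j + ((2 * s j : ℕ) : ℤ) := by
    intro i hi j
    have h1 := hbox𝔏 i.2 (S.mem_unkA.mp hi).2 j
    rw [abs_le] at h1
    simp only [hv, Pi.sub_apply]
    push_cast
    constructor <;> omega
  have hslab : ∀ i ∈ U, |S.Lsum (v i) - 0| ≤ w := by
    intro i hi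
    have h1 := hc₀ i.2 (S.mem_unkA.mp hi).2
    have h2 := hc₀ lamb hlamb
    have e1 : S.Lsum (v i) = S.Lsum i.2 - S.Lsum lamb := by simp only [hv]; rw [S.sub_Lsum]
    rw [e1, sub_zero, abs_le]
    constructor <;> linarith [h1.1, h1.2, h2.1, h2.2]
  have hvan : ∀ x : ℤ, x ∈ {x : ℤ | |x| ≤ (X₀ : ℤ)} → ∀ (a : ℕ) (μ : Fin S.n → ℕ), a + ∑ k, μ k < T₀ →
      S.archφ R v U (S.pvΔ v pv c e μ) ((a, 0) : Tau S.n) x = 0 := by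
    intro x hx a μ haμ
    by_cases hμ : 0 < μ S.j₀
    · exact S.archφ_pvΔ_eq_zero_of_pivot_pos R v U pv c he hμ _ x
    · have hμ0 : μ S.j₀ = 0 := by omega
      have hq : (x, ((a, μ) : Tau S.n)) ∈ E := by
        rw [hEdef, mem_product, mem_Icc, mem_tauSetR]
        have hx' : |x| ≤ (X₀ : ℤ) := hx
        rw [abs_le] at hx'
        refine ⟨⟨hx'.1, hx'.2⟩, ?_, hμ0⟩
        unfold tauNorm; simpa using haμ
      rw [S.archφ_pvΔ_zero_eq_sum R v U pv c e μ a x]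
      have h := hsol (x, ((a, μ) : Tau S.n)) hq
      simp only at h
      exact h
  exact ⟨𝔏, lamb, pv, h𝔏𝔅, hlamb,
    { nonzero := hnz
      bound := fun i _ => hbd i
      lo_le := hlo
      box := hboxv
      slab := hslab
      c_ne := hc
      vanish := hvan }⟩

/-- **The level-`0` STATE** for the schedule: with the level weights `R₀ ℓ₀ = Δ(2^{Ŝ}Y₀; ℓ₀, H)` (`scaledFeldR ℓ₀ H (Ŝ − 0)`), slab radius
`wl 0 = w`, centre bound `0 ≤ γb 0`, Δ-basis `(cl 0, el 0) = (c, e)`, the START gives `ArchLevelState S H Ŝ s U pv P wl γb cl el 0 X₀ T₀` with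
`U = unkA L₀ 𝔏` itself as the unknown set. [cite: Nesterenko2003, §4 (4.6) at s = 0, p. 80–81] -/
theorem archLevelState_zero {A : Fin S.n → ℝ} (hA : ∀ j, |S.lg j| ≤ A j) (s : Fin S.n → ℕ) {𝔅 : Finset (Fin S.n → ℤ)}
    (h𝔅 : 𝔅 ⊆ S.boxA s) (H Sh L₀ X₀ T₀ : ℕ) (hT₀ : 1 ≤ T₀) (wl γb : ℕ → ℝ) (hw : 0 < wl 0) (hγb : 0 ≤ γb 0)
    (cl : ℕ → ℤ) (el : ℕ → Fin S.n → ℤ) (hc : cl 0 ≠ 0) (he : el 0 S.j₀ = 0)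
    (E : Finset (ℤ × Tau S.n)) (hEdef : E = Icc (-(X₀ : ℤ)) X₀ ×ˢ tauSetR S.n S.j₀ T₀)
    (hcount : 2 * E.card * (2 * ⌈(∑ j, (s j : ℝ) * A j) / wl 0⌉₊ + 1) ≤ (L₀ + 1) * 𝔅.card)
    (den₀ : ℤ × Tau S.n → ℕ) (hden₀ : ∀ q ∈ E, 1 ≤ den₀ q) (M₀ : ℤ × Tau S.n → ℤ)
    (hR : ∀ q ∈ E, ∀ ℓ₀ ≤ L₀, ∃ z₀ : ℤ,
      (den₀ q : ℚ) * (hasseDeriv q.2.1 (scaledFeldR ℓ₀ H (Sh - 0))).eval (q.1 : ℚ) = z₀ ∧ |z₀| ≤ M₀ q)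
    {DΔ : ℝ} (hDΔ : ∀ w' : Fin S.n → ℤ, (∀ j, |w' j| ≤ ((2 * s j : ℕ) : ℤ)) → ∀ q ∈ E,
      |((∏ k, Ring.multichoose (S.yΔ (cl 0) (el 0) w' k) (q.2.2 k) : ℤ) : ℝ)| ≤ DΔ)
    {Amax : ℝ} (hAmax : 1 ≤ Amax)
    (hAm : ∀ q ∈ E, DΔ * (M₀ q : ℝ) * ((MonomialDen.monDen S.α (fun j => 2 * s j * q.1.natAbs) : ℝ)) ^ 2 ≤ Amax) :
    ∃ (𝔏 : Finset (Fin S.n → ℤ)) (pv : ℕ × (Fin S.n → ℤ) → ℤ), 𝔏 ⊆ 𝔅 ∧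
      S.ArchLevelState H Sh s (S.unkA L₀ 𝔏) pv ⌈((S.unkA L₀ 𝔏).card : ℝ) * Amax⌉ wl γb cl el 0 X₀ T₀ := by
  obtain ⟨𝔏, lamb, pv, h𝔏𝔅, _, h⟩ := S.start_delta hA s h𝔅 L₀ X₀ T₀ hT₀ (fun ℓ₀ => scaledFeldR ℓ₀ H (Sh - 0)) hw hc he E hEdef hcount
    den₀ hden₀ M₀ hR hDΔ hAmax hAm
  refine ⟨𝔏, pv, h𝔏𝔅, S.unkA L₀ 𝔏, fun i => i.2 - lamb, fun j => -(s j : ℤ) - lamb j, 0, subset_refl _, ?_, by simpa using hγb, ?_⟩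
  · -- injectivity in `λ`
    intro i _ i' _
    exact sub_left_inj
  · -- the box of the schedule at level 0 is `Lb s 0 = 2s`
    exact h

end ArchG3Setup

end Summit.ABC.StewartYu

end
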